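import Summits.BirchSwinnertonDyer.BirchSwinnertonDyer.Theorems.SignedLowerHalvesSmallImageLowerHalfBothSignsRttColemanLimit
import Literature.NumberTheory.GaloisRepresentations.LocalTatePairingLevelChange
import Mathlib.NumberTheory.Padics.RingHoms
import HarnessLib

/-!
# Route `SignedLowerHalves`, crux L `SmallImageLowerHalfBothSigns` (stmt-BirchSwinnertonDyer-23599), line `rtt_w3` v34 — row S4″ (`stub_junctionRecipMT_ns`), brick β4, part C4a:
# `λ`-READOUTS — A `p`-DIVISIBLE TOWER OF `ℚ/ℤ`-VALUED ADDITIVE MAPS ON `𝒪` IS `r ↦ λ(r·t)/p^k` FOR ONE `t ∈ 𝒪` (the Pontryagin dual of `F_S/𝒪_S` is `𝒪_S` through a perfect `λ`)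

WIDTH seat `bsd-line-slh-p3-w3` g28 under LEAD `cruxlead-stmt-BirchSwinnertonDyer-23599` g14 (cell `bsd-ssimc`; design memo `Lines/rtt_w3-MEMO-w3-g28-beta4.md` §2; RULING «β4-KERNEL»
11:57:49Z). Helper `--supports stmt-BirchSwinnertonDyer-23599`. THEOREMS ONLY; no definition, no named fact, no instance, no `sorry`. HONEST FRAMING: the `𝒪`-valued bookkeeping behind
the evaluations `ev n i x = ⟨x, γ_v^i(d_n^ε ⊗ p^{−∞})⟩_𝒪` of β4 — how a functional `x ∈ DQ.X = Hom(E^ε_{sat,v}, ℚ/ℤ)` is READ as an element of `𝒪` on a `p`-divisible sequence of classes,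
through the stub's perfect `ℤ_p`-linear form `λ : 𝒪 → ℤ_p` (`hlam`, `hlamInj`, `hlamSurj` of `CharRoadRecipMT`, with `lamZMod S lam m = toZModPow m ∘ λ` unfolded); S4″, crux L and BSD
remain OPEN and are proved for NO curve.

* §1 `ℚ/ℤ` bookkeeping: every `n`-torsion element of `ℚ/ℤ` is in the image of `ℤ/n` (`exists_zmodToQmodZ_eq_of_nsmul_eq_zero`); the level change
  `(toZModPow (k+1) (p·w))/p^{k+1} = (toZModPow k w)/p^k` in `ℚ/ℤ` (`zmodToQmodZ_toZModPow_succ_mul`).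
* §2 ★ `exists_readout_level` / `sub_mem_span_pow_of_readout_level`: an additive `φ : 𝒪 → ℚ/ℤ` killing `p^k𝒪` is `r ↦ λ_k(r t)/p^k` for some `t`, unique mod `p^k` (perfectness of `λ`);
  ★★ `exists_readout` / `readout_unique`: a tower `φ_k` with `φ_k(p^k r) = 0` and `φ_k(r) = φ_{k+1}(p r)` is read by ONE `t ∈ 𝒪` at every level (levelwise readouts are compatible; Cantor's
  intersection theorem in the compact `𝒪`, `UniversalNorms.compactSpace_padicCoeffIntegers`), uniquely (`⋂ p^k𝒪 = 0`, C1); `readout_add`, `readout_mul` (the readout of `φ + φ′` / of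
  `r ↦ φ(a r)`).
References: [NeukirchSchmidtWingberg2008] (7.2.6); [Rubin2000] §4.2, App. B.2; [SerreLocalFields1979] II §1 Prop. 1, III §3; [KimPark2017] §3.5 (the `O_p`-valued Kummer pairing `⟨ , ⟩_{K(𝔣p^∞)_𝔞}`).
-/

set_option autoImplicit false
set_option linter.dupNamespace false -- D-0017: single-problem summit, the namespace repeats the problem name by design
noncomputable section

open scoped Classical
open Filter Topology Literature

namespace Summit.BirchSwinnertonDyer.BirchSwinnertonDyer.Theorems.SmallImageRttReciprocity

open Literature.NumberTheory.EllipticCurves Literature.NumberTheory.GaloisRepresentations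
open Literature.AnabelianGeometry.AbsoluteAnabelian.Prop121vii (zmodToQmodZ zmodToQmodZ_apply zmodToQmodZ_injective)

/-! ## §1. `ℚ/ℤ` bookkeeping -/

section QmodZ

variable {p : ℕ} [hp : Fact p.Prime]

omit hp in
/-- **Every `n`-torsion element of `ℚ/ℤ` lies in `(1/n)ℤ/ℤ`**: `n • y = 0 ⟹ y = zmodToQmodZ n z` for some `z ∈ ℤ/n`. [folklore] -/
theorem exists_zmodToQmodZ_eq_of_nsmul_eq_zero (n : ℕ) [NeZero n] (y : AddCircle (1 : ℚ)) (h : n • y = 0) : ∃ z : ZMod n, zmodToQmodZ n z = y := by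
  obtain ⟨q, rfl⟩ := QuotientAddGroup.mk_surjective y
  change n • ((q : ℚ) : AddCircle (1 : ℚ)) = 0 at h
  rw [← AddCircle.coe_nsmul, AddCircle.coe_eq_zero_iff] at h
  obtain ⟨m, hm⟩ := h
  refine ⟨(m : ZMod n), ?_⟩
  rw [zmodToQmodZ, ZMod.lift_coe]
  change ((((m : ℚ)) / n : ℚ) : AddCircle (1 : ℚ)) = ((q : ℚ) : AddCircle (1 : ℚ))
  congr 1
  rw [zsmul_eq_mul, mul_one] at hm
  rw [nsmul_eq_mul] at hm
  have hn : (n : ℚ) ≠ 0 := Nat.cast_ne_zero.2 (NeZero.ne n)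
  rw [hm, mul_div_cancel_left₀ _ hn]

/-- **Level change in `ℚ/ℤ`**: `(toZModPow (k+1) (p·w))/p^{k+1} = (toZModPow k w)/p^k` (`toZModPow (k+1) (p w) = p·(lift of toZModPow k w)` and the tree's `zmodToQmodZ_natCast_val_mul_div`).
[cite: SerreLocalFields1979, XIII §3 Cor. 3] -/
theorem zmodToQmodZ_toZModPow_succ_mul (k : ℕ) (w : ℤ_[p]) :
    zmodToQmodZ (p ^ (k + 1)) (PadicInt.toZModPow (k + 1) ((p : ℤ_[p]) * w)) = zmodToQmodZ (p ^ k) (PadicInt.toZModPow k w) := by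
  haveI : NeZero (p ^ k) := ⟨pow_ne_zero _ hp.out.ne_zero⟩
  haveI : NeZero (p ^ (k + 1)) := ⟨pow_ne_zero _ hp.out.ne_zero⟩
  have hdvd : p ^ k ∣ p ^ (k + 1) := pow_dvd_pow p (Nat.le_succ k)
  have hdiv : p ^ (k + 1) / p ^ k = p := by rw [pow_succ, Nat.mul_div_cancel_left p (pow_pos hp.out.pos k)]
  rw [← zmodToQmodZ_natCast_val_mul_div hdvd (PadicInt.toZModPow k w), hdiv]
  congr 1
  set y : ZMod (p ^ (k + 1)) := PadicInt.toZModPow (k + 1) w with hy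
  have hx : PadicInt.toZModPow k w = (y.val : ZMod (p ^ k)) := by
    rw [hy, ← ZMod.cast_eq_val, PadicInt.cast_toZModPow k (k + 1) (Nat.le_succ k)]
  rw [map_mul, map_natCast, ← hy, hx, ZMod.val_natCast]
  conv_lhs => rw [← ZMod.natCast_zmod_val y, ← Nat.div_add_mod' (y.val) (p ^ k)]
  push_cast
  have hz : ((p : ZMod (p ^ (k + 1)))) ^ (k + 1) = 0 := by rw [← Nat.cast_pow, ZMod.natCast_self]
  linear_combination ((y.val / p ^ k : ℕ) : ZMod (p ^ (k + 1))) * hz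

end QmodZ

/-! ## §2. `λ`-readouts -/

section Readout

variable {p : ℕ} [hp : Fact p.Prime] (S : Set (PadicAlgCl p)) (lam : padicCoeffIntegers S →+ ℤ_[p])
  (hlam : ∀ (c : ℤ_[p]) (y : padicCoeffIntegers S), lam (padicIntToCoeffIntegers S c * y) = c * lam y)
  (hlamInj : ∀ (m : ℕ) (t : padicCoeffIntegers S), (∀ b : padicCoeffIntegers S, PadicInt.toZModPow m (lam (b * t)) = 0) →
    t ∈ Ideal.span {((p : ℕ) : padicCoeffIntegers S) ^ m})
  (hlamSurj : ∀ (m : ℕ) (g : padicCoeffIntegers S →+ ZMod (p ^ m)), ∃ t : padicCoeffIntegers S, ∀ b : padicCoeffIntegers S, g b = PadicInt.toZModPow m (lam (b * t)))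

include hlam in
/-- `λ_k(p^k · y) = 0`. [folklore] -/
theorem toZModPow_lam_pow_mul (k : ℕ) (y : padicCoeffIntegers S) : PadicInt.toZModPow k (lam (((p : ℕ) : padicCoeffIntegers S) ^ k * y)) = 0 := by
  rw [show ((p : ℕ) : padicCoeffIntegers S) ^ k = padicIntToCoeffIntegers S ((p : ℤ_[p]) ^ k) by rw [map_pow, map_natCast], hlam, map_mul, map_pow, map_natCast,
    ← Nat.cast_pow, ZMod.natCast_self, zero_mul]

include hlam in
/-- The readout at level `k` only depends on `t mod p^k`. [folklore] -/
theorem toZModPow_lam_mul_eq_of_sub_mem (k : ℕ) {t t' : padicCoeffIntegers S} (h : t - t' ∈ Ideal.span {((p : ℕ) : padicCoeffIntegers S) ^ k}) (r : padicCoeffIntegers S) :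
    PadicInt.toZModPow k (lam (r * t)) = PadicInt.toZModPow k (lam (r * t')) := by
  obtain ⟨c, hc⟩ := Ideal.mem_span_singleton'.mp h
  rw [← sub_eq_zero, ← map_sub, ← map_sub, ← mul_sub, ← hc, mul_comm c, ← mul_assoc, mul_comm r, mul_assoc]
  exact toZModPow_lam_pow_mul S lam hlam k (r * c)

include hlamSurj in
/-- ★ **Readout at one level**: an additive `φ : 𝒪 → ℚ/ℤ` killing `p^k 𝒪` is `r ↦ λ_k(r·t)/p^k` for some `t ∈ 𝒪` (values are `p^k`-torsion, hence in `(1/p^k)ℤ/ℤ ≅ ℤ/p^k`;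
then the surjectivity half of the perfectness of `λ`). [cite: NeukirchSchmidtWingberg2008, (7.2.6)] [cite: Rubin2000, §4.2] -/
theorem exists_readout_level (k : ℕ) (φ : padicCoeffIntegers S →+ AddCircle (1 : ℚ)) (hφ : ∀ r : padicCoeffIntegers S, φ (((p : ℕ) : padicCoeffIntegers S) ^ k * r) = 0) :
    ∃ t : padicCoeffIntegers S, ∀ r : padicCoeffIntegers S, φ r = (haveI : NeZero (p ^ k) := ⟨pow_ne_zero _ hp.out.ne_zero⟩; zmodToQmodZ (p ^ k) (PadicInt.toZModPow k (lam (r * t)))) := by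
  haveI : NeZero (p ^ k) := ⟨pow_ne_zero _ hp.out.ne_zero⟩
  have htors : ∀ r : padicCoeffIntegers S, (p ^ k) • φ r = 0 := fun r ↦ by
    rw [← map_nsmul, nsmul_eq_mul, Nat.cast_pow, hφ]
  choose z hz using fun r ↦ exists_zmodToQmodZ_eq_of_nsmul_eq_zero (p ^ k) (φ r) (htors r)
  -- `z` is additive because `zmodToQmodZ` is injective
  let g : padicCoeffIntegers S →+ ZMod (p ^ k) :=
    { toFun := z
      map_zero' := zmodToQmodZ_injective (p ^ k) (by rw [hz, map_zero, map_zero])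
      map_add' := fun a b ↦ zmodToQmodZ_injective (p ^ k) (by rw [hz, map_add, map_add, hz, hz]) }
  obtain ⟨t, ht⟩ := hlamSurj k g
  exact ⟨t, fun r ↦ by rw [← hz r, show z r = g r from rfl, ht]⟩

include hlamInj in
/-- ★ **Uniqueness mod `p^k` of the level-`k` readout** (injectivity of `zmodToQmodZ`, then the injectivity half of the perfectness of `λ`). [cite: NeukirchSchmidtWingberg2008, (7.2.6)] -/
theorem sub_mem_span_pow_of_readout_level (k : ℕ) (φ : padicCoeffIntegers S →+ AddCircle (1 : ℚ)) {t t' : padicCoeffIntegers S}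
    (ht : ∀ r : padicCoeffIntegers S, φ r = (haveI : NeZero (p ^ k) := ⟨pow_ne_zero _ hp.out.ne_zero⟩; zmodToQmodZ (p ^ k) (PadicInt.toZModPow k (lam (r * t)))))
    (ht' : ∀ r : padicCoeffIntegers S, φ r = (haveI : NeZero (p ^ k) := ⟨pow_ne_zero _ hp.out.ne_zero⟩; zmodToQmodZ (p ^ k) (PadicInt.toZModPow k (lam (r * t'))))) :
    t - t' ∈ Ideal.span {((p : ℕ) : padicCoeffIntegers S) ^ k} := by
  haveI : NeZero (p ^ k) := ⟨pow_ne_zero _ hp.out.ne_zero⟩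
  refine hlamInj k (t - t') fun b ↦ ?_
  rw [mul_sub, map_sub, map_sub, sub_eq_zero]
  exact zmodToQmodZ_injective (p ^ k) (by rw [← ht b, ← ht' b])

variable [FiniteDimensional ℚ_[p] (padicCoeffField S)]

include hlam hlamInj hlamSurj in
/-- ★★ **Readout of a tower**: additive maps `φ_k : 𝒪 → ℚ/ℤ` with `φ_k(p^k r) = 0` and `φ_k(r) = φ_{k+1}(p r)` (the values of ONE functional on a `p`-divisible sequence of classes
`p·e_{k+1} = e_k`) are ALL read by one `t ∈ 𝒪`: `φ_k(r) = λ_k(r t)/p^k` (levelwise readouts `t_k`, compatible `t_{k+1} ≡ t_k (mod p^k)` by uniqueness and the level change in `ℚ/ℤ`;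
Cantor's intersection theorem in the compact `𝒪`). [cite: NeukirchSchmidtWingberg2008, (7.2.6)] [cite: Rubin2000, App. B.2] [cite: SerreLocalFields1979, II §1 Prop. 1] -/
theorem exists_readout (φ : ℕ → (padicCoeffIntegers S →+ AddCircle (1 : ℚ))) (hφ : ∀ (k : ℕ) (r : padicCoeffIntegers S), φ k (((p : ℕ) : padicCoeffIntegers S) ^ k * r) = 0)
    (hcompat : ∀ (k : ℕ) (r : padicCoeffIntegers S), φ k r = φ (k + 1) (((p : ℕ) : padicCoeffIntegers S) * r)) :
    ∃ t : padicCoeffIntegers S, ∀ (k : ℕ) (r : padicCoeffIntegers S),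
      φ k r = (haveI : NeZero (p ^ k) := ⟨pow_ne_zero _ hp.out.ne_zero⟩; zmodToQmodZ (p ^ k) (PadicInt.toZModPow k (lam (r * t)))) := by
  haveI : CompactSpace (padicCoeffIntegers S) := Kato2004.UniversalNorms.compactSpace_padicCoeffIntegers S
  choose t ht using fun k ↦ exists_readout_level S lam hlamSurj k (φ k) (hφ k)
  -- compatibility of the levelwise readouts
  have hcomp : ∀ k, t (k + 1) - t k ∈ Ideal.span {((p : ℕ) : padicCoeffIntegers S) ^ k} := fun k ↦ by
    refine sub_mem_span_pow_of_readout_level S lam hlamInj k (φ k) (fun r ↦ ?_) (ht k)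
    haveI : NeZero (p ^ (k + 1)) := ⟨pow_ne_zero _ hp.out.ne_zero⟩
    rw [hcompat k r, ht (k + 1), show ((p : ℕ) : padicCoeffIntegers S) * r * t (k + 1) = padicIntToCoeffIntegers S (p : ℤ_[p]) * (r * t (k + 1)) by
      rw [map_natCast, mul_assoc], hlam]
    exact zmodToQmodZ_toZModPow_succ_mul k _
  -- Cantor's intersection theorem on the cosets `t_k + p^k 𝒪`
  let C : ℕ → Set (padicCoeffIntegers S) := fun k ↦ {s | s - t k ∈ Ideal.span {((p : ℕ) : padicCoeffIntegers S) ^ k}}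
  have hCdef : ∀ k s, s ∈ C k ↔ s - t k ∈ Ideal.span {((p : ℕ) : padicCoeffIntegers S) ^ k} := fun k s ↦ Iff.rfl
  have hanti : ∀ k, C (k + 1) ⊆ C k := fun k s hs ↦ by
    rw [hCdef] at hs ⊢
    have h := Ideal.add_mem _ (Ideal.span_singleton_le_span_singleton.mpr (pow_dvd_pow _ (Nat.le_succ k)) hs) (hcomp k)
    rwa [sub_add_sub_cancel] at h
  have hne : ∀ k, (C k).Nonempty := fun k ↦ ⟨t k, by rw [hCdef, sub_self]; exact Ideal.zero_mem _⟩
  have hcl : ∀ k, IsClosed (C k) := fun k ↦ by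
    have hC' : C k = (fun s ↦ s - t k) ⁻¹' Set.range (fun y : padicCoeffIntegers S ↦ y * ((p : ℕ) : padicCoeffIntegers S) ^ k) := by
      ext s
      rw [hCdef, Set.mem_preimage, Set.mem_range, Ideal.mem_span_singleton']
    rw [hC']
    exact ((isCompact_range (continuous_id.mul continuous_const)).isClosed).preimage (continuous_id.sub continuous_const)
  obtain ⟨s, hs⟩ := IsCompact.nonempty_iInter_of_sequence_nonempty_isCompact_isClosed C hanti hne (hcl 0).isCompact hcl
  refine ⟨s, fun k r ↦ ?_⟩
  rw [ht k r]
  have h := Set.mem_iInter.mp hs k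
  rw [hCdef] at h
  have h' : t k - s ∈ Ideal.span {((p : ℕ) : padicCoeffIntegers S) ^ k} := by
    rw [← neg_sub]; exact Submodule.neg_mem _ h
  exact congrArg _ (toZModPow_lam_mul_eq_of_sub_mem S lam hlam k h' r)

omit [FiniteDimensional ℚ_[p] (padicCoeffField S)] in
include hlamInj in
/-- ★ **Uniqueness of the readout of a tower** (`t − t′ ∈ ⋂_k p^k𝒪 = 0`). [cite: SerreLocalFields1979, II §1 Prop. 1] -/
theorem readout_unique (φ : ℕ → (padicCoeffIntegers S →+ AddCircle (1 : ℚ))) {t t' : padicCoeffIntegers S}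
    (ht : ∀ (k : ℕ) (r : padicCoeffIntegers S), φ k r = (haveI : NeZero (p ^ k) := ⟨pow_ne_zero _ hp.out.ne_zero⟩; zmodToQmodZ (p ^ k) (PadicInt.toZModPow k (lam (r * t)))))
    (ht' : ∀ (k : ℕ) (r : padicCoeffIntegers S), φ k r = (haveI : NeZero (p ^ k) := ⟨pow_ne_zero _ hp.out.ne_zero⟩; zmodToQmodZ (p ^ k) (PadicInt.toZModPow k (lam (r * t'))))) :
    t = t' := by
  rw [← sub_eq_zero]
  refine eq_zero_of_forall_mem_span_pow S (t - t') fun N ↦ ?_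
  have h := sub_mem_span_pow_of_readout_level S lam hlamInj N (φ N) (ht N) (ht' N)
  simpa only [Nat.cast_id] using h

omit [FiniteDimensional ℚ_[p] (padicCoeffField S)] in
/-- The readout of a sum: if `t` reads `φ` and `t′` reads `φ′` then `t + t′` reads `φ + φ′`. [folklore] -/
theorem readout_add (φ φ' : ℕ → (padicCoeffIntegers S →+ AddCircle (1 : ℚ))) {t t' : padicCoeffIntegers S}
    (ht : ∀ (k : ℕ) (r : padicCoeffIntegers S), φ k r = (haveI : NeZero (p ^ k) := ⟨pow_ne_zero _ hp.out.ne_zero⟩; zmodToQmodZ (p ^ k) (PadicInt.toZModPow k (lam (r * t)))))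
    (ht' : ∀ (k : ℕ) (r : padicCoeffIntegers S), φ' k r = (haveI : NeZero (p ^ k) := ⟨pow_ne_zero _ hp.out.ne_zero⟩; zmodToQmodZ (p ^ k) (PadicInt.toZModPow k (lam (r * t')))))
    (k : ℕ) (r : padicCoeffIntegers S) :
    φ k r + φ' k r = (haveI : NeZero (p ^ k) := ⟨pow_ne_zero _ hp.out.ne_zero⟩; zmodToQmodZ (p ^ k) (PadicInt.toZModPow k (lam (r * (t + t'))))) := by
  rw [ht, ht', mul_add, map_add, map_add, map_add]

omit [FiniteDimensional ℚ_[p] (padicCoeffField S)] in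
/-- The readout of a precomposition with a scalar: if `t` reads `φ` then `a·t` reads `r ↦ φ(a r)`. [folklore] -/
theorem readout_mul (φ : ℕ → (padicCoeffIntegers S →+ AddCircle (1 : ℚ))) {t : padicCoeffIntegers S} (a : padicCoeffIntegers S)
    (ht : ∀ (k : ℕ) (r : padicCoeffIntegers S), φ k r = (haveI : NeZero (p ^ k) := ⟨pow_ne_zero _ hp.out.ne_zero⟩; zmodToQmodZ (p ^ k) (PadicInt.toZModPow k (lam (r * t)))))
    (k : ℕ) (r : padicCoeffIntegers S) :
    φ k (a * r) = (haveI : NeZero (p ^ k) := ⟨pow_ne_zero _ hp.out.ne_zero⟩; zmodToQmodZ (p ^ k) (PadicInt.toZModPow k (lam (r * (a * t))))) := by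
  rw [ht, show a * r * t = r * (a * t) by ring]

end Readout

end Summit.BirchSwinnertonDyer.BirchSwinnertonDyer.Theorems.SmallImageRttReciprocity

end
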